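import Summits.NavierStokesRegularity.TurbBounds.SpectralFormFreeSlip
import Summits.NavierStokesRegularity.TurbBounds.FSU1.Mode.M01Calculus
import Summits.NavierStokesRegularity.TurbBounds.FSU1.Mode.M03Defs

/-!
# FS-U1″ mode lemma — StiffnessEven (`TurbBounds/FSU1/Mode/M13StiffnessEven.lean`)

FS-PROOF-DRAFT §3.6, even class: `V′(0)² ≤ M·[1 + g₊(m̃+1)/(m̃−1) + 2ε₁/(m̃−1)]·W_half` — `SE.stiffnessEven : StiffnessEven`.

Cell-made mathematics of FS-PROOF-DRAFT §3 (pub-turb-sos), kernel-checked; generated from the design compose file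
`StageF_compose.check.lean` (96c4b9bf…) by `build_mode_split.py`.  HONEST FRAMING: rigorous bounds for the stated PDE and boundary conditions; no claim about physical turbulence beyond the bound.
-/

open Real intervalIntegral MeasureTheory Set

namespace Summit.NavierStokesRegularity.TurbBounds.FSU1.Mode

open Summit.NavierStokesRegularity.TurbBounds.SpectralFormFreeSlip

namespace SE

/-! ### 1. Elementary calculus -/

/-! ### 2. Regularity of `V ∈ C³` and of `Ω = vort k V` (verbatim idiom of Stage C) -/

/-! ### 3. The explicit test functions (Neumann weight `g_m`, mixed test function `φ_E`) -/

/-- `g_m(x) = cosh m(L−x) / cosh mL`. -/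
noncomputable def gE (m L x : ℝ) : ℝ := Real.cosh (m * (L - x)) / Real.cosh (m * L)
/-- `g_m'`. -/
noncomputable def dgE (m L x : ℝ) : ℝ := -m * Real.sinh (m * (L - x)) / Real.cosh (m * L)

/-- Derivative of the Neumann weight `g_E(x) = cosh(k(L−x))/cosh(kL)`. -/
theorem hasDerivAt_gE (m L x : ℝ) : HasDerivAt (gE m L) (dgE m L x) x := by
  unfold gE dgE
  exact (hasDerivAt_cosh_lin m L x).div_const (Real.cosh (m * L))

/-- Second derivative of `g_E`. -/
theorem hasDerivAt_dgE (m L x : ℝ) : HasDerivAt (dgE m L) (m ^ 2 * gE m L x) x := by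
  unfold gE dgE
  have h := ((hasDerivAt_sinh_lin m L x).const_mul (-m)).div_const (Real.cosh (m * L))
  have e : -m * (-m * Real.cosh (m * (L - x))) / Real.cosh (m * L)
      = m ^ 2 * (Real.cosh (m * (L - x)) / Real.cosh (m * L)) := by ring
  rw [e] at h
  exact h

/-- `φ_E = A (g_k − g_μ)`: `φ_E(0) = 0`, `φ_E'(L) = 0`, `−αφ_E'' + νφ_E = k g_k` (`A = k/β₀`). -/
noncomputable def phiE (A k μ L x : ℝ) : ℝ := A * (gE k L x - gE μ L x)
/-- `φ_E'`. -/
noncomputable def dphiE (A k μ L x : ℝ) : ℝ := A * (dgE k L x - dgE μ L x)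
/-- `φ_E''`. -/
noncomputable def ddphiE (A k μ L x : ℝ) : ℝ := A * (k ^ 2 * gE k L x - μ ^ 2 * gE μ L x)

/-- Derivative of the even-class test function `φ_E = A(g_{E,k} − g_{E,μ})`. -/
theorem hasDerivAt_phiE (A k μ L x : ℝ) : HasDerivAt (phiE A k μ L) (dphiE A k μ L x) x := by
  unfold phiE dphiE
  exact ((hasDerivAt_gE k L x).sub (hasDerivAt_gE μ L x)).const_mul A

/-- Second derivative of `φ_E`. -/
theorem hasDerivAt_dphiE (A k μ L x : ℝ) : HasDerivAt (dphiE A k μ L) (ddphiE A k μ L x) x := by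
  unfold dphiE ddphiE
  exact ((hasDerivAt_dgE k L x).sub (hasDerivAt_dgE μ L x)).const_mul A

/-- Operator identity for the even test function: `−α·φ_E″ + (αk²+β₀)·φ_E = k·g_{E,k}` (given `A·β₀ = k` and `α·μ² = α·k² + β₀`). -/
theorem opE {α β₀ k μ A : ℝ} (hA : A * β₀ = k) (hαμ : α * μ ^ 2 = α * k ^ 2 + β₀) (L x : ℝ) :
    -α * ddphiE A k μ L x + (α * k ^ 2 + β₀) * phiE A k μ L x = k * gE k L x := by
  unfold ddphiE phiE
  linear_combination (gE k L x) * hA + (A * gE μ L x) * hαμ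

/-! ### 4. Closed forms of `m_e = ∫ g_k²` and `n_e = ∫ g_k g_μ` -/

/-- Closed form of `∫₀^L g_k²` for the even profile `gE k L` (`k ≠ 0`): `(sinh(kL)cosh(kL)/(2k) + L/2)/cosh(kL)²`. -/
theorem int_gE_sq (k L : ℝ) (hk : k ≠ 0) :
    ∫ x in (0:ℝ)..L, gE k L x * gE k L x
      = (Real.sinh (k * L) * Real.cosh (k * L) / (2 * k) + L / 2) / Real.cosh (k * L) ^ 2 := by
  have hP : ∀ x, HasDerivAt (fun x => -(Real.sinh (k * (L - x)) * Real.cosh (k * (L - x)) / (2 * k) + (L - x) / 2)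
      / Real.cosh (k * L) ^ 2) (gE k L x * gE k L x) x := by
    intro x
    have h1 := hasDerivAt_sinh_lin k L x
    have h2 := hasDerivAt_cosh_lin k L x
    have h3 : HasDerivAt (fun x : ℝ => (L - x) / 2) ((0 - 1) / 2) x :=
      ((hasDerivAt_const x L).sub (hasDerivAt_id x)).div_const 2
    have h4 := ((((h1.mul h2).div_const (2 * k)).add h3).neg).div_const (Real.cosh (k * L) ^ 2)
    refine h4.congr_deriv ?_
    unfold gE
    have cs := Real.cosh_sq (k * (L - x))
    have e1 : -k * Real.cosh (k * (L - x)) * Real.cosh (k * (L - x))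
        + Real.sinh (k * (L - x)) * (-k * Real.sinh (k * (L - x)))
        = -k * (2 * Real.cosh (k * (L - x)) ^ 2 - 1) := by
      linear_combination k * cs
    rw [e1]
    field_simp
    ring
  have cI : Continuous fun x => gE k L x * gE k L x := by unfold gE; fun_prop
  rw [intervalIntegral.integral_eq_sub_of_hasDerivAt (fun x _ => hP x) (cI.intervalIntegrable _ _)]
  simp only [sub_self, mul_zero, Real.sinh_zero, Real.cosh_zero, zero_mul, zero_div, zero_add, sub_zero]
  ring

/-- Closed form of `∫₀^L g_{E,k}·g_{E,μ}` (hyperbolic product integral; `μ ≠ ±k`). -/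
theorem int_gE_gE (k μ L : ℝ) (hp : μ + k ≠ 0) (hm : μ - k ≠ 0) (hck : Real.cosh (k * L) ≠ 0)
    (hcμ : Real.cosh (μ * L) ≠ 0) :
    ∫ x in (0:ℝ)..L, gE k L x * gE μ L x
      = (Real.sinh ((μ + k) * L) / (2 * (μ + k)) + Real.sinh ((μ - k) * L) / (2 * (μ - k)))
          / (Real.cosh (k * L) * Real.cosh (μ * L)) := by
  have hP : ∀ x, HasDerivAt (fun x => -(Real.sinh ((μ + k) * (L - x)) / (2 * (μ + k))
      + Real.sinh ((μ - k) * (L - x)) / (2 * (μ - k))) / (Real.cosh (k * L) * Real.cosh (μ * L)))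
      (gE k L x * gE μ L x) x := by
    intro x
    have h1 := hasDerivAt_sinh_lin (μ + k) L x
    have h2 := hasDerivAt_sinh_lin (μ - k) L x
    have h4 := (((h1.div_const (2 * (μ + k))).add (h2.div_const (2 * (μ - k)))).neg).div_const
      (Real.cosh (k * L) * Real.cosh (μ * L))
    refine h4.congr_deriv ?_
    unfold gE
    have ea : Real.cosh ((μ + k) * (L - x))
        = Real.cosh (μ * (L - x)) * Real.cosh (k * (L - x)) + Real.sinh (μ * (L - x)) * Real.sinh (k * (L - x)) := by
      rw [show (μ + k) * (L - x) = μ * (L - x) + k * (L - x) by ring, Real.cosh_add]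
    have eb : Real.cosh ((μ - k) * (L - x))
        = Real.cosh (μ * (L - x)) * Real.cosh (k * (L - x)) - Real.sinh (μ * (L - x)) * Real.sinh (k * (L - x)) := by
      rw [show (μ - k) * (L - x) = μ * (L - x) - k * (L - x) by ring, Real.cosh_sub]
    rw [ea, eb]
    field_simp
    ring
  have cI : Continuous fun x => gE k L x * gE μ L x := by unfold gE; fun_prop
  rw [intervalIntegral.integral_eq_sub_of_hasDerivAt (fun x _ => hP x) (cI.intervalIntegrable _ _)]
  simp only [sub_self, mul_zero, Real.sinh_zero, zero_div, zero_add, sub_zero]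
  ring

/-! ### 5. The scalar chain of §3.6 -/

/-- `m_e = (1 + g₊(k))/(2k)` for `L = 1/2`. -/
theorem me_eq {k L : ℝ} (hk : 0 < k) (hL : L = 1 / 2) :
    (Real.sinh (k * L) * Real.cosh (k * L) / (2 * k) + L / 2) / Real.cosh (k * L) ^ 2
      = 1 / (2 * k) + gplus k / (2 * k) := by
  subst hL
  unfold gplus
  have hs : Real.sinh (k * (1 / 2)) * Real.cosh (k * (1 / 2)) = Real.sinh k / 2 := by
    have := Real.sinh_two_mul (k * (1 / 2))
    rw [show 2 * (k * (1 / 2)) = k by ring] at this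
    linarith
  have hc : Real.cosh (k * (1 / 2)) ^ 2 = (Real.cosh k + 1) / 2 := by
    have h1 := Real.cosh_two_mul (k * (1 / 2))
    have h2 := Real.cosh_sq (k * (1 / 2))
    rw [show 2 * (k * (1 / 2)) = k by ring] at h1
    linarith
  rw [hs, hc, Real.sinh_eq, Real.cosh_eq]
  set u := Real.exp k with hu
  have hu' : Real.exp (-k) = u⁻¹ := by rw [hu]; exact Real.exp_neg k
  rw [hu']
  have hu0 : 0 < u := by rw [hu]; exact Real.exp_pos k
  have h1u : 1 + u⁻¹ ≠ 0 := by positivity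
  have h2u : u + u⁻¹ + 1 * 2 ≠ 0 := by positivity
  have h3u : (u + u⁻¹) / 2 + 1 ≠ 0 := by positivity
  field_simp
  ring

/-- `n_e ≥ (1 − ε₁)/(μ+k)` for `L = 1/2`. -/
theorem ne_lb {k μ L : ℝ} (hk : 0 < k) (hkμ : k < μ) (hL : L = 1 / 2) :
    (1 - (Real.exp (-((μ + k) / 2)) + Real.exp (-((μ - k) / 2))) / Real.sinh ((μ + k) / 2)) / (μ + k)
      ≤ (Real.sinh ((μ + k) * L) / (2 * (μ + k)) + Real.sinh ((μ - k) * L) / (2 * (μ - k)))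
          / (Real.cosh (k * L) * Real.cosh (μ * L)) := by
  subst hL
  have hP : 0 < (μ + k) / 2 := by linarith
  have hQ : 0 < (μ - k) / 2 := by linarith
  have e1 : (μ + k) * (1 / 2) = (μ + k) / 2 := by ring
  have e2 : (μ - k) * (1 / 2) = (μ - k) / 2 := by ring
  have e3 : Real.cosh (k * (1 / 2)) * Real.cosh (μ * (1 / 2))
      = (Real.cosh ((μ + k) / 2) + Real.cosh ((μ - k) / 2)) / 2 := by
    rw [show (μ + k) / 2 = μ * (1 / 2) + k * (1 / 2) by ring,
      show (μ - k) / 2 = μ * (1 / 2) - k * (1 / 2) by ring, Real.cosh_add, Real.cosh_sub]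
    ring
  rw [e1, e2, e3]
  have hsP : 0 < Real.sinh ((μ + k) / 2) := Real.sinh_pos_iff.2 hP
  have hsQ : 0 ≤ Real.sinh ((μ - k) / 2) := Real.sinh_nonneg_iff.2 hQ.le
  have hcQ : 1 ≤ Real.cosh ((μ - k) / 2) := Real.one_le_cosh _
  have h1 := Real.cosh_sub_sinh ((μ + k) / 2)
  have h2 := Real.cosh_sub_sinh ((μ - k) / 2)
  have hxP := Real.exp_pos (-((μ + k) / 2))
  have hxQ := Real.exp_pos (-((μ - k) / 2))
  have hD : 0 < (Real.cosh ((μ + k) / 2) + Real.cosh ((μ - k) / 2)) / 2 := by linarith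
  have hmk : (0:ℝ) < μ + k := by linarith
  rw [div_le_div_iff₀ hmk hD]
  have eq1 : (Real.sinh ((μ + k) / 2) / (2 * (μ + k)) + Real.sinh ((μ - k) / 2) / (2 * (μ - k))) * (μ + k)
      = Real.sinh ((μ + k) / 2) / 2 + Real.sinh ((μ - k) / 2) * (μ + k) / (2 * (μ - k)) := by
    have : μ - k ≠ 0 := by linarith
    field_simp
  have eq2 : (1 - (Real.exp (-((μ + k) / 2)) + Real.exp (-((μ - k) / 2))) / Real.sinh ((μ + k) / 2))
        * ((Real.cosh ((μ + k) / 2) + Real.cosh ((μ - k) / 2)) / 2)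
      = (Real.cosh ((μ + k) / 2) + Real.cosh ((μ - k) / 2)) / 2
        - (Real.cosh ((μ + k) / 2) + Real.cosh ((μ - k) / 2))
          * (Real.exp (-((μ + k) / 2)) + Real.exp (-((μ - k) / 2))) / (2 * Real.sinh ((μ + k) / 2)) := by
    field_simp
  have i1 : Real.sinh ((μ - k) / 2) / 2 ≤ Real.sinh ((μ - k) / 2) * (μ + k) / (2 * (μ - k)) := by
    rw [le_div_iff₀ (by linarith)]
    nlinarith [mul_nonneg hsQ hk.le]
  have i2 : (Real.exp (-((μ + k) / 2)) + Real.exp (-((μ - k) / 2))) / 2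
      ≤ (Real.cosh ((μ + k) / 2) + Real.cosh ((μ - k) / 2))
          * (Real.exp (-((μ + k) / 2)) + Real.exp (-((μ - k) / 2))) / (2 * Real.sinh ((μ + k) / 2)) := by
    rw [le_div_iff₀ (by positivity)]
    have hge : 0 ≤ Real.cosh ((μ + k) / 2) + Real.cosh ((μ - k) / 2) - Real.sinh ((μ + k) / 2) := by linarith
    nlinarith [mul_nonneg (add_pos hxP hxQ).le hge]
  rw [eq1, eq2]
  linarith

/-- The final identity `(k²/β₀)[(1+g)/(2k) − (1−e)/(μ+k)] = M·[1 + g(m̃+1)/(m̃−1) + 2e/(m̃−1)]`. -/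
theorem fin_id {α k μ G e : ℝ} (hα : 0 < α) (hk : 0 < k) (hkμ : k < μ) :
    k * (k / (α * (μ ^ 2 - k ^ 2))) * (1 / (2 * k) + G / (2 * k))
        - k * (k / (α * (μ ^ 2 - k ^ 2))) * ((1 - e) / (μ + k))
      = k / (2 * α * (k + μ) ^ 2) * (1 + G * ((μ / k + 1) / (μ / k - 1)) + 2 * e / (μ / k - 1)) := by
  have h1 : μ ^ 2 - k ^ 2 ≠ 0 := by nlinarith
  have h2 : μ + k ≠ 0 := by linarith
  have h2' : k + μ ≠ 0 := by linarith
  have h4 : μ / k + 1 = (μ + k) / k := by field_simp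
  have h5 : μ / k - 1 = (μ - k) / k := by field_simp
  rw [h4, h5]
  have h6 : μ - k ≠ 0 := by linarith
  field_simp
  ring

/-! ### 6. The theorem -/

/-- Stage D, even class: `V'(0)² ≤ M·[1 + g₊(m̃+1)/(m̃−1) + 2ε₁/(m̃−1)]·W_half`. -/
theorem stiffnessEven : StiffnessEven := by
  intro α β₀ k V hα hβ hk hV hV0 hV2 hV1L _hV3L
  -- constants
  have hL : (0:ℝ) < 1 / 2 := by norm_num
  set L : ℝ := 1 / 2 with hLdef
  set μ := muR α β₀ k with hμdef
  have hμsq : μ ^ 2 = k ^ 2 + β₀ / α := by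
    rw [hμdef]; unfold muR; exact Real.sq_sqrt (by positivity)
  have hμpos : 0 < μ := by
    rw [hμdef]; unfold muR; exact Real.sqrt_pos.2 (by positivity)
  have hq : 0 < β₀ / α := div_pos hβ hα
  have hkμ : k < μ := by nlinarith
  have hαμ : α * μ ^ 2 = α * k ^ 2 + β₀ := by
    rw [hμsq]; field_simp
  have hβ' : β₀ = α * (μ ^ 2 - k ^ 2) := by linarith [hαμ]
  set A := k / β₀ with hAdef
  have hA : A * β₀ = k := by rw [hAdef]; field_simp
  have hApos : 0 < A := div_pos hk hβ
  have hν : (0:ℝ) ≤ α * k ^ 2 + β₀ := by positivity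
  -- regularity of V and Ω
  obtain ⟨hd0, hd1, hd2⟩ := diff_pack hV
  have hVd : ∀ x, HasDerivAt V (deriv V x) x := fun x => (hd0 x).hasDerivAt
  have hVdd : ∀ x, HasDerivAt (deriv V) (deriv (deriv V) x) x := fun x => (hd1 x).hasDerivAt
  set Ω := vort k V with hΩdef
  have hΩd : ∀ x, HasDerivAt Ω (deriv Ω x) x := fun x => ((differentiable_vort hV k) x).hasDerivAt
  have cΩ' : Continuous (deriv Ω) := continuous_deriv_vort hV k
  have cΩ : Continuous Ω := (differentiable_vort hV k).continuous
  have hΩ0 : Ω 0 = 0 := by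
    rw [hΩdef]; unfold vort; rw [hV2, hV0]; simp
  have hkΩ : ∀ x, k * Ω x = deriv (deriv V) x - k ^ 2 * V x := by
    intro x; rw [hΩdef]; unfold vort; field_simp
  have hck : Real.cosh (k * L) ≠ 0 := (Real.cosh_pos _).ne'
  have hcμ : Real.cosh (μ * L) ≠ 0 := (Real.cosh_pos _).ne'
  -- (1) representation of V'(0)
  have rep : deriv V 0 = -∫ x in (0:ℝ)..L, gE k L x * (k * Ω x) := by
    have cg'' : Continuous fun x => k ^ 2 * gE k L x := by unfold gE; fun_prop
    have G := green (a := (0:ℝ)) (b := L) k (fun x => hasDerivAt_gE k L x) (fun x => hasDerivAt_dgE k L x)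
      hVd hVdd cg'' hd2.continuous
    have z : (∫ x in (0:ℝ)..L, V x * (k ^ 2 * gE k L x - k ^ 2 * gE k L x)) = 0 := by simp
    have g0 : gE k L 0 = 1 := by unfold gE; rw [sub_zero]; exact div_self hck
    have gL : dgE k L L = 0 := by unfold dgE; simp
    rw [z, hV1L, hV0, g0, gL] at G
    have e : (∫ x in (0:ℝ)..L, gE k L x * (k * Ω x))
        = ∫ x in (0:ℝ)..L, gE k L x * (deriv (deriv V) x - k ^ 2 * V x) := by
      congr 1; funext x; rw [hkΩ]
    rw [e, G]; ring
  -- (2) ∫ k g_k Ω = a(φ_E, Ω)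
  have cddE : Continuous (ddphiE A k μ L) := by unfold ddphiE gE; fun_prop
  have cdE : Continuous (dphiE A k μ L) := by unfold dphiE dgE; fun_prop
  have cE : Continuous (phiE A k μ L) := by unfold phiE gE; fun_prop
  have dφEL : dphiE A k μ L L = 0 := by unfold dphiE dgE; simp
  have φE0 : phiE A k μ L 0 = 0 := by
    unfold phiE gE; rw [sub_zero, div_self hck, div_self hcμ]; ring
  have I1 := ibp α (α * k ^ 2 + β₀) L (fun x => hasDerivAt_phiE A k μ L x) (fun x => hasDerivAt_dphiE A k μ L x)
    hΩd cddE cΩ'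
  simp only [dφEL, hΩ0, zero_mul, mul_zero, sub_zero] at I1
  have e1 : (∫ x in (0:ℝ)..L, gE k L x * (k * Ω x))
      = ∫ x in (0:ℝ)..L, (-α * ddphiE A k μ L x + (α * k ^ 2 + β₀) * phiE A k μ L x) * Ω x := by
    congr 1; funext x; rw [opE hA hαμ]; ring
  have CS := wcs (L := L) hα.le hν hL.le cdE cE cΩ' cΩ
  -- (3) a(φ_E) ≤ M·bracket
  have aE_le : (∫ x in (0:ℝ)..L, (α * dphiE A k μ L x ^ 2 + (α * k ^ 2 + β₀) * phiE A k μ L x ^ 2))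
      ≤ Mhalf α β₀ k * evenBracket α β₀ k := by
    -- X = ∫ k g_k φ_E = kA m_e − kA n_e
    have I2 := ibp α (α * k ^ 2 + β₀) L (fun x => hasDerivAt_phiE A k μ L x) (fun x => hasDerivAt_dphiE A k μ L x)
      (fun x => hasDerivAt_phiE A k μ L x) cddE cdE
    simp only [dφEL, φE0, zero_mul, mul_zero, sub_zero] at I2
    have cgg : Continuous fun x => gE k L x * gE k L x := by unfold gE; fun_prop
    have cgm : Continuous fun x => gE k L x * gE μ L x := by unfold gE; fun_prop
    have eX : (∫ x in (0:ℝ)..L, (α * dphiE A k μ L x ^ 2 + (α * k ^ 2 + β₀) * phiE A k μ L x ^ 2))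
        = k * A * (∫ x in (0:ℝ)..L, gE k L x * gE k L x) - k * A * (∫ x in (0:ℝ)..L, gE k L x * gE μ L x) := by
      have e2 : (∫ x in (0:ℝ)..L, (α * dphiE A k μ L x ^ 2 + (α * k ^ 2 + β₀) * phiE A k μ L x ^ 2))
          = ∫ x in (0:ℝ)..L, (α * (dphiE A k μ L x * dphiE A k μ L x)
              + (α * k ^ 2 + β₀) * (phiE A k μ L x * phiE A k μ L x)) := by
        congr 1; funext x; ring
      rw [e2, ← I2]
      have e3 : (∫ x in (0:ℝ)..L, (-α * ddphiE A k μ L x + (α * k ^ 2 + β₀) * phiE A k μ L x) * phiE A k μ L x)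
          = ∫ x in (0:ℝ)..L, (k * A * (gE k L x * gE k L x) - k * A * (gE k L x * gE μ L x)) := by
        congr 1; funext x; rw [opE hA hαμ]; unfold phiE; ring
      rw [e3, intervalIntegral.integral_sub ((cgg.const_mul _).intervalIntegrable _ _)
        ((cgm.const_mul _).intervalIntegrable _ _), intervalIntegral.integral_const_mul,
        intervalIntegral.integral_const_mul]
    rw [eX, int_gE_sq k L hk.ne', int_gE_gE k μ L (by positivity) (by linarith) hck hcμ,
      me_eq hk hLdef]
    have hne := ne_lb hk hkμ hLdef
    have hkA : 0 ≤ k * A := by positivity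
    have step := mul_le_mul_of_nonneg_left hne hkA
    have fin := fin_id (G := gplus k)
      (e := (Real.exp (-((μ + k) / 2)) + Real.exp (-((μ - k) / 2))) / Real.sinh ((μ + k) / 2)) hα hk hkμ
    unfold Mhalf evenBracket mtR eps1 Pof Qof
    rw [← hμdef]
    rw [hAdef, hβ'] at step ⊢
    linarith [fin, step]
  -- (4) assemble
  have hW : Wh α β₀ k V = ∫ x in (0:ℝ)..L, (α * deriv Ω x ^ 2 + (α * k ^ 2 + β₀) * Ω x ^ 2) := by
    rw [hΩdef]; unfold Wh; rw [← hLdef]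
  have hWnn : 0 ≤ ∫ x in (0:ℝ)..L, (α * deriv Ω x ^ 2 + (α * k ^ 2 + β₀) * Ω x ^ 2) :=
    intervalIntegral.integral_nonneg hL.le (fun x _ => by positivity)
  rw [hW]
  calc deriv V 0 ^ 2 = (∫ x in (0:ℝ)..L, gE k L x * (k * Ω x)) ^ 2 := by rw [rep]; ring
    _ = (∫ x in (0:ℝ)..L, (α * (dphiE A k μ L x * deriv Ω x) + (α * k ^ 2 + β₀) * (phiE A k μ L x * Ω x))) ^ 2 := by
        rw [e1, I1]
    _ ≤ (∫ x in (0:ℝ)..L, (α * dphiE A k μ L x ^ 2 + (α * k ^ 2 + β₀) * phiE A k μ L x ^ 2))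
          * (∫ x in (0:ℝ)..L, (α * deriv Ω x ^ 2 + (α * k ^ 2 + β₀) * Ω x ^ 2)) := CS
    _ ≤ Mhalf α β₀ k * evenBracket α β₀ k * (∫ x in (0:ℝ)..L, (α * deriv Ω x ^ 2 + (α * k ^ 2 + β₀) * Ω x ^ 2)) :=
        mul_le_mul_of_nonneg_right aE_le hWnn

end SE

end Summit.NavierStokesRegularity.TurbBounds.FSU1.Mode
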